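/- Copyright: the b2b-balaban cell (near-miss cell 7), T⁴-continuum fan-out; row NE7b ROUND-2 swarm, seat
t4-ne7b-formalise-leaf-06 (gen 5) (road W-RP, supplier «W3g» file 2 of 2: THE LEVEL-0 RP-PACKAGE IN THE `Setup`
VOCABULARY; INTENT journal l.15271).  Released under the licence of the surrounding project. -/
import Summits.QuantumFields.BalabanUV.T4Continuum.Support.HistoryRPGibbsState
import Summits.QuantumFields.BalabanUV.T4Continuum.Support.HistoryRPBlocks
import Summits.QuantumFields.BalabanUV.T4Continuum.Support.HistoryRPAveragingCuts
import Summits.QuantumFields.BalabanUV.T4Continuum.Support.HistoryRPDeterministic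

/-!
# Road W-RP, supplier «W3g» (file 2): the LEVEL-0 RP-package of the cell's Gibbs state, in Bałaban's `Setup` vocabulary

Summits-side support leaf of the T⁴-continuum cell (rung (B)+1 on a FINITE torus only; NOT infinite volume, NOT the
mass gap, NOT the Clay statement; NOT a proof of the spine estimate NE7b).  Row NE7b, road **W-RP** (owner rulings
R-OWNER-23-2 ∕ R-OWNER-23-8), the piece reserved for this lineage by leaf-06 g4 (journal l.14995 (iii)) and left
DISPLAYED by sub-row W3f (leaf-04 g6, l.15071: «base RP in the `Setup` vocabulary (level 0: transport of W3c along
`TorusReflectionPositivity.ofConfig`) … stays DISPLAYED»).  [folklore] bookkeeping over the TREE'S OWN theorems,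
consumed BY NAME: W3c's base package `HistoryRPBase.rpPackage_wilson_theta` (the tree's PROVED Osterwalder–Seiler
positivity of the torus Wilson state `wilsonMeasure` at every fine hyperplane), this lineage's
`HistoryRPBlocks.theta_swap_eq_configReflect` and file 1 `HistoryRPGibbsState` (`map_toConfig_gibbsMeasure`: the Gibbs
state read through `toConfig` IS `wilsonMeasure ϱ (β∕N)`; `measurePreserving_creflect`), W3f file 1 `HistoryRPHalfTorus`
(leaf-04 g6: the half-torus `posBonds`, the positive σ-algebra `mPos`, `creflect_comp_self`, `measurable_creflect`), W-CUTS
`HistoryRPAveragingCuts.toConfig_translate_creflect` (leaf-02 g8: the dictionary reads the centre reflection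
`GaugeField.creflect ρ` of [B12] (2.17) as the road's `configReflect ρ (n − 1)`), W3d `HistoryRPDeterministic` (junction
check).  No `def`, no `structure`, no `[cite:]` tag, nothing printed asserted, no estimate of [B12]–[B16] used, no Bałaban
object beyond the cell's OWN level-0 definitions instantiated.

WHAT.
* §0 (abstract) `isReflectionPositiveBdd_anti` (fewer positive observables); **`isReflectionPositiveBdd_transfer`**:
  bounded reflection positivity is transported BACK along a measurable map `e : Ω → Ω′` with a two-sided inverse `e′`,
  `μ.map e = ν` and `e ∘ θ = θ′ ∘ e` (no Doob–Dynkin: `g = (g ∘ e′) ∘ e`; the two-type companion of W3c's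
  `rpPackage_conj` and W4b′'s `rpPackage_pullback`).
* §1 THE REFLECTION DICTIONARY at the centre cut: `toConfig (U.creflect ρ) = configReflect ρ (−1) (toConfig U)`
  (`toConfig_creflect`, W-CUTS at `n = 0`) `= Θ_{swap 0 ρ, −e_ρ} (toConfig U)` (`toConfig_creflect_theta`, W3c's letters).
* §2 THE POSITIVE σ-ALGEBRA: W3f's `mPos G 0 ρ` sits below W3c's transported positive σ-algebra pulled back along
  `toConfig` (`mPos_le_comap`): a positive bond of the half-torus `0 ≤ x_ρ < N₀∕2` is read by W3c's `Φ` (`phi_apply_sub`)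
  on an Osterwalder–Seiler positive link, time coordinate `x_ρ + 1 ∈ [1, N₀∕2]` (`isPosEdge_of_mem_posBonds`).
* §3 **THE PACKAGE `rpPackage_gibbs_creflect`**: for `β ≥ 0` and every axis `ρ`, the five sentences
  `mPos G 0 ρ ≤ m`, `Measurable (creflect ρ)`, `MeasurePreserving (creflect ρ) (gibbsMeasure P β) (gibbsMeasure P β)`,
  `creflect ρ ∘ creflect ρ = id`, `IsReflectionPositiveBdd (gibbsMeasure P β) (mPos G 0 ρ) (creflect ρ)` — the displayed
  base package `(hm, hθm, hθ, hθθ, hRP)` of `HistoryRPDeterministic.rpPackage_level_deterministic` ∕ W3f at level `0`,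
  now a THEOREM for the cell's level-0 state (group hypotheses of `TorusReflectionPositivity`);
  `rpPackage_gibbs_creflect_SU` the hypothesis-free `SU(N)` case.
* §4 sanity: §3 feeds one δ-averaging level of W3d BY NAME (type-check `example`).

HONEST SCOPE (c4).  The CENTRE cut of each axis only (the other block-boundary cuts are its conjugates by the exact
symmetries `IsExpectSymmetry.translate` ∕ W-CUTS; W3e's cell-torus family `(i, k)` needs the `sitesPerDir 0 = N·b` cast
and is not attempted here); NO field of W4b′'s `CutoffReading` for Bałaban's EXTENDED state is discharged (levels `≥ 1`
are W3b ∕ W3d ∕ W3f), nothing of (EXT)∕(LOC)∕(R-sym)∕(U1)∕(G2), nothing of H3 ∕ (B) ∕ BetaPertH; the identification «the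
run's level-0 law is `gibbsMeasure (F.P K) β_K`» is the cell's own DEFINITION of its torus schemes (`T4Assembly`,
`T4CanonicalTiltRate`), not a reading of Bałaban; no exit ∕ socket ∕ `HistoryConstants` ∕ END touched (c3), no `Prop`
fact minted (c1), no constant (c2∕c6).  NE7b NOT proved; spine 0∕9.  HONEST DEPENDENCY (cell): continuum YM on T⁴ ⇐
BetaPertH ∧ nine spine estimates (0/9 proved); BetaPertH ⇐ (D1) ∧ (D4) ∧ CAP+tail; G-an2-4 gates asym, D1 and NE2/3/4.
This file changes none of it.
-/

open MeasureTheory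
open Literature.MathematicalPhysics.QuantumFieldTheory
open Literature.MathematicalPhysics.QuantumFieldTheory.LatticeRP (IsReflectionPositiveBdd)
open Literature.MathematicalPhysics.QuantumFieldTheory.Balaban1983to89
open Summit.QuantumFields.YangMills.Theorems.ContinuumLegGivenGap (configReflect)
open Summit.QuantumFields.BalabanUV.T4Continuum.HistoryRPHalfTorus (posBonds mPos mem_posBonds mPos_le
  creflect_comp_self measurable_creflect)

namespace Summit.QuantumFields.BalabanUV.T4Continuum.HistoryRPGibbs

noncomputable section

/-! ## §0 Two abstract remarks on bounded reflection positivity -/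

section Abstract

variable {Ω Ω' : Type*} {mP mQ : MeasurableSpace Ω} {mP' : MeasurableSpace Ω'} [m : MeasurableSpace Ω]
  [m' : MeasurableSpace Ω']

/-- FEWER POSITIVE OBSERVABLES: bounded reflection positivity for `mP` gives it for every `mQ ≤ mP`. [folklore] -/
theorem isReflectionPositiveBdd_anti {μ : Measure Ω} {θ : Ω → Ω} (hle : mQ ≤ mP)
    (hRP : IsReflectionPositiveBdd μ mP θ) : IsReflectionPositiveBdd μ mQ θ :=
  fun g hg hgb => hRP g (hg.mono hle le_rfl) hgb

/-- **BOUNDED REFLECTION POSITIVITY IS TRANSPORTED BACK ALONG A MEASURABLE MAP WITH A TWO-SIDED INVERSE.**  `e : Ω → Ω′`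
measurable, `e′` with `e′ (e ω) = ω` and `e (e′ v) = v`, `μ.map e = ν`, `θ′` measurable with `e (θ ω) = θ′ (e ω)`, `ν`
reflection positive for `(mP′, θ′)`, `mP′ ≤ m′` ⇒ `μ` reflection positive for `(mP′.comap e, θ)`: a bounded
`mP′.comap e`-measurable `g` is `(g ∘ e′) ∘ e` with `g ∘ e′` bounded and `mP′`-measurable (`e′` is
`mP′ → mP′.comap e` measurable because `e ∘ e′ = id`), and `∫ g(θω) g(ω) dμ = ∫ h(θ′v) h(v) dν ≥ 0`. [folklore] -/
theorem isReflectionPositiveBdd_transfer (hm' : mP' ≤ m') {μ : Measure Ω} {ν : Measure Ω'}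
    {e : Ω → Ω'} {e' : Ω' → Ω} (he : Measurable e) (hee' : ∀ ω, e' (e ω) = ω) (he'e : ∀ v, e (e' v) = v)
    (hμν : μ.map e = ν) {θ : Ω → Ω} {θ' : Ω' → Ω'} (hθ' : Measurable θ') (hcomm : ∀ ω, e (θ ω) = θ' (e ω))
    (hRP : IsReflectionPositiveBdd ν mP' θ') : IsReflectionPositiveBdd μ (mP'.comap e) θ := by
  intro g hg hgb
  obtain ⟨C, hC⟩ := hgb
  -- `e'` reads `mP'` into `mP'.comap e`
  have he'P : Measurable[mP', mP'.comap e] e' := by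
    refine measurable_iff_comap_le.2 ?_
    rw [MeasurableSpace.comap_comp]
    have hid : e ∘ e' = id := funext he'e
    rw [hid, MeasurableSpace.comap_id]
  have hh : Measurable[mP'] (g ∘ e') := hg.comp he'P
  have hhm : Measurable (g ∘ e') := hh.mono hm' le_rfl
  have hgh : ∀ ω, g ω = (g ∘ e') (e ω) := fun ω => by rw [Function.comp_apply, hee']
  have hF : AEStronglyMeasurable (fun v => (g ∘ e') (θ' v) * (g ∘ e') v) (μ.map e) :=
    ((hhm.comp hθ').mul hhm).aestronglyMeasurable
  have key : ∫ ω, g (θ ω) * g ω ∂μ = ∫ v, (g ∘ e') (θ' v) * (g ∘ e') v ∂ν := by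
    rw [← hμν, integral_map he.aemeasurable hF]
    refine integral_congr_ae (ae_of_all _ fun ω => ?_)
    dsimp only
    rw [hgh (θ ω), hgh ω, hcomm]
  show 0 ≤ ∫ ω, g (θ ω) * g ω ∂μ
  rw [key]
  exact hRP (g ∘ e') hh ⟨C, fun v => hC (e' v)⟩

end Abstract

/-! ## §1 The reflection dictionary at the centre cut -/

section Reflection

variable {P : Params} {G : Type*} [GaugeGroup G]

/-- **`toConfig (c_ρ U) = configReflect ρ (−1) (toConfig U)`**: the centre reflection of axis `ρ` read through the
dictionary is the road's wall reflection at the cut `−1 ∣ 0` (W-CUTS `toConfig_translate_creflect` at `n = 0`).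
[folklore] -/
theorem toConfig_creflect (ρ : Fin P.d) (U : GaugeField P 0 G) :
    toConfig (U.creflect ρ) = configReflect ρ (-1) (toConfig U) := by
  have h := HistoryRPAveragingCuts.toConfig_translate_creflect ρ 0 U
  rwa [zero_nsmul, GaugeField.translate_zero, Nat.cast_zero, zero_sub] at h

variable [MeasurableSpace G]

/-- **THE SAME IN W3c's LETTERS**: with the tree vector `v := −e_ρ` (`Pi.single ρ (−1)`), the centre reflection read
through the dictionary is W3c's transported Osterwalder–Seiler reflection `Θ_{swap 0 ρ, v} = τ_v ∘ π_* ∘ Θ₀ ∘ π_*⁻¹ ∘ τ_{−v}`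
(this lineage's `theta_swap_eq_configReflect`: `Θ_{swap 0 ρ, v} = configReflect ρ (2v_ρ + 1)`, and `2·(−1) + 1 = −1`).
[folklore] -/
theorem toConfig_creflect_theta (ρ : Fin P.d) (U : GaugeField P 0 G) :
    toConfig (U.creflect ρ) =
      torusConfigShift (Pi.single ρ (-1) : Fin P.d → ZMod (P.sitesPerDir 0)) (configPerm (Equiv.swap 0 ρ)
        (GaugeConfig.timeReflect (configPerm (Equiv.swap 0 ρ).symm
          (torusConfigShift (-(Pi.single ρ (-1) : Fin P.d → ZMod (P.sitesPerDir 0))) (toConfig U))))) := by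
  rw [HistoryRPBlocks.theta_swap_eq_configReflect, toConfig_creflect, Pi.single_eq_same]
  congr 1
  ring

end Reflection

/-! ## §2 The positive σ-algebra: W3f's `mPos G 0 ρ` lies below W3c's transported positive σ-algebra -/

section Sigma

variable {P : Params} {G : Type*} [MeasurableSpace G]

/-- W3c's conjugating map `Φ = π_*⁻¹ ∘ τ_{−v}` at `π = swap 0 i` READS the pulled-back link
`(sitePerm (swap 0 i) (x − v), swap 0 i μ)` as the original link `(x, μ)` — this lineage's
`HistoryRPBlocks.phi_apply_pullback`, stated for an arbitrary side `L` (there: `N·b`). [folklore] -/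
theorem phi_apply_sub {d L : ℕ} [NeZero d] (i : Fin d) (v : Fin d → ZMod L) (V : GaugeConfig d L G) (e : Edge d L) :
    configPerm (Equiv.swap 0 i).symm (torusConfigShift (-v) V) (sitePerm (Equiv.swap 0 i) (e.1 - v), Equiv.swap 0 i e.2) =
      V e := by
  rw [configPerm_apply, torusConfigShift_apply]
  simp only [Equiv.symm_swap, Equiv.swap_apply_self, sub_neg_eq_add]
  obtain ⟨x, μ⟩ := e
  congr 2
  funext κ
  simp only [Pi.add_apply, sitePerm_apply, Equiv.symm_swap, Equiv.swap_apply_self, Pi.sub_apply, sub_add_cancel]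

/-- **A POSITIVE BOND IS READ ON AN OSTERWALDER–SEILER POSITIVE LINK**: if the bond `⟨x, μ⟩` lies in `posBonds P 0 ρ`
(both endpoints with `x_ρ < N₀∕2`), the link `(sitePerm (swap 0 ρ) (x − v), swap 0 ρ μ)`, `v = −e_ρ` — the one W3c's `Φ`
reads as `(x, μ)` (`phi_apply_sub`) — has time coordinate `x_ρ + 1 ∈ [1, N₀∕2]` at both ends. [folklore] -/
theorem isPosEdge_of_mem_posBonds {ρ : Fin P.d} (e : Edge P.d (P.sitesPerDir 0))
    (he : (⟨e.1, e.2⟩ : PBond P 0) ∈ posBonds P 0 ρ) :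
    WilsonRP.IsPosEdge (d := P.d) (L := P.sitesPerDir 0)
      (sitePerm (Equiv.swap 0 ρ) (e.1 - Pi.single ρ (-1)), Equiv.swap 0 ρ e.2) := by
  obtain ⟨h1, h2⟩ := mem_posBonds.1 he
  rw [PBond.tgt] at h2
  dsimp only at h1 h2
  rw [shift_eq_shift] at h2
  have hN2 : 2 * (P.sitesPerDir 0 / 2) = P.sitesPerDir 0 := HistoryRPHalfTorus.two_mul_half_sitesPerDir P 0
  -- the value of `x + 1` for `x.val < N/2` (no wrap-around)
  have hval : ∀ x : ZMod (P.sitesPerDir 0), x.val < P.sitesPerDir 0 / 2 → (x + 1).val = x.val + 1 := by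
    intro x hx
    rw [ZMod.val_add_of_lt, ZMod.val_one]
    rw [ZMod.val_one]; omega
  have e1 : sitePerm (Equiv.swap (0 : Fin P.d) ρ) (e.1 - Pi.single ρ (-1)) 0 = e.1 ρ + 1 := by
    rw [sitePerm_apply, Equiv.symm_swap, Equiv.swap_apply_left, Pi.sub_apply, Pi.single_eq_same, sub_neg_eq_add]
  have e2 : (Literature.MathematicalPhysics.QuantumFieldTheory.Site.shift (sitePerm (Equiv.swap (0 : Fin P.d) ρ)
      (e.1 - Pi.single ρ (-1))) (Equiv.swap 0 ρ e.2)) 0 =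
      (Literature.MathematicalPhysics.QuantumFieldTheory.Site.shift e.1 e.2) ρ + 1 := by
    rw [← sitePerm_shift, sitePerm_apply, Equiv.symm_swap, Equiv.swap_apply_left]
    simp only [Literature.MathematicalPhysics.QuantumFieldTheory.Site.shift, Pi.add_apply, Pi.sub_apply,
      Pi.single_eq_same]
    ring
  unfold WilsonRP.IsPosEdge
  dsimp only
  rw [e1, e2, hval _ h1, hval _ h2]
  omega

/-- **W3f's POSITIVE σ-ALGEBRA AT LEVEL 0 LIES BELOW W3c's TRANSPORTED ONE, PULLED BACK ALONG `toConfig`**: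
`mPos G 0 ρ ≤ ((piFinset posEdges).comap Φ_{swap 0 ρ, −e_ρ}).comap toConfig` — every coordinate `U ↦ U b`, `b` a
positive bond, is the positive-link coordinate `W ↦ W e′` of `Φ (toConfig U)` (`phi_apply_sub`,
`isPosEdge_of_mem_posBonds`). [folklore] -/
theorem mPos_le_comap (ρ : Fin P.d) :
    mPos G 0 ρ ≤
      ((Filtration.piFinset (X := fun _ : Edge P.d (P.sitesPerDir 0) => G) WilsonRP.posEdges :
          MeasurableSpace (GaugeConfig P.d (P.sitesPerDir 0) G)).comap
        (fun W : GaugeConfig P.d (P.sitesPerDir 0) G => configPerm (Equiv.swap 0 ρ).symm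
          (torusConfigShift (-(Pi.single ρ (-1) : Fin P.d → ZMod (P.sitesPerDir 0))) W))).comap
        (toConfig (P := P) (j := 0) (G := G)) := by
  set v : Fin P.d → ZMod (P.sitesPerDir 0) := Pi.single ρ (-1) with hv
  set mP₀ := (Filtration.piFinset (X := fun _ : Edge P.d (P.sitesPerDir 0) => G) WilsonRP.posEdges :
      MeasurableSpace (GaugeConfig P.d (P.sitesPerDir 0) G)) with hmP₀
  set Φ := fun W : GaugeConfig P.d (P.sitesPerDir 0) G => configPerm (Equiv.swap 0 ρ).symm
    (torusConfigShift (-v) W) with hΦ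
  have hΨm : @Measurable _ _ ((mP₀.comap Φ).comap (toConfig (P := P) (j := 0) (G := G))) mP₀
      (fun U : GaugeField P 0 G => Φ (toConfig U)) :=
    measurable_iff_comap_le.2 (by rw [MeasurableSpace.comap_comp]; rfl)
  have hcoord : ∀ e' ∈ (WilsonRP.posEdges : Finset (Edge P.d (P.sitesPerDir 0))),
      @Measurable _ _ mP₀ _ (fun W : GaugeConfig P.d (P.sitesPerDir 0) G => W e') := by
    intro e' he'
    have hres : @Measurable _ _ mP₀ _
        ((WilsonRP.posEdges : Finset (Edge P.d (P.sitesPerDir 0))) : Set (Edge P.d (P.sitesPerDir 0))).restrict :=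
      measurable_iff_comap_le.2 (by rw [hmP₀, Filtration.piFinset_eq_comap_restrict])
    exact (measurable_pi_apply (⟨e', Finset.mem_coe.2 he'⟩ :
      ↥((WilsonRP.posEdges : Finset (Edge P.d (P.sitesPerDir 0))) : Set (Edge P.d (P.sitesPerDir 0))))).comp hres
  show (Filtration.piFinset (X := fun _ : PBond P 0 => G) (posBonds P 0 ρ) : MeasurableSpace (PBond P 0 → G)) ≤ _
  rw [Filtration.piFinset_eq_comap_restrict]
  refine measurable_iff_comap_le.1 ((@measurable_pi_iff _ _ _ ((mP₀.comap Φ).comap toConfig) _ _).2 fun b => ?_)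
  obtain ⟨⟨x, μ⟩, hb₀⟩ := b
  -- the bond `⟨x, μ⟩` read as the tree link `(x, μ)`
  have hpos : (sitePerm (Equiv.swap 0 ρ) (((x, μ) : Edge P.d (P.sitesPerDir 0)).1 - v),
      Equiv.swap 0 ρ ((x, μ) : Edge P.d (P.sitesPerDir 0)).2) ∈ (WilsonRP.posEdges : Finset (Edge P.d (P.sitesPerDir 0))) :=
    WilsonRP.mem_posEdges.2 (isPosEdge_of_mem_posBonds ((x, μ) : Edge P.d (P.sitesPerDir 0)) (Finset.mem_coe.1 hb₀))
  -- `Φ (toConfig U)` reads the pulled-back link as `U ⟨x, μ⟩`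
  have hread : (fun U : GaugeField P 0 G => U ⟨x, μ⟩) =
      (fun W : GaugeConfig P.d (P.sitesPerDir 0) G =>
          W (sitePerm (Equiv.swap 0 ρ) (((x, μ) : Edge P.d (P.sitesPerDir 0)).1 - v),
            Equiv.swap 0 ρ ((x, μ) : Edge P.d (P.sitesPerDir 0)).2)) ∘ fun U : GaugeField P 0 G => Φ (toConfig U) := by
    funext U
    exact (phi_apply_sub ρ v (toConfig U) ((x, μ) : Edge P.d (P.sitesPerDir 0))).symm
  show @Measurable _ _ ((mP₀.comap Φ).comap toConfig) _ (fun U : GaugeField P 0 G => U ⟨x, μ⟩)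
  rw [hread]
  exact (hcoord _ hpos).comp hΨm

end Sigma

/-! ## §3 The package: the level-0 Gibbs state is reflection positive across the centre cut of every axis -/

section Package

variable {P : Params} {G : Type*} [GaugeGroup G] [MeasurableSpace G] [RegularGaugeGroup G] [HaarData G]
  [TopologicalSpace G] [IsTopologicalGroup G] [CompactSpace G] [BorelSpace G]
  {N : ℕ} (ϱ : G →* Matrix (Fin N) (Fin N) ℂ)

/-- **THE LEVEL-0 RP-PACKAGE IN THE `Setup` VOCABULARY.**  For `β ≥ 0`, every axis `ρ`, and a compact group `G` under
the hypotheses of `TorusReflectionPositivity` (`HaarData` = normalised Haar, `reTr = Re tr ϱ ∕ N` for a continuous matrix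
representation `ϱ`, `N ≠ 0`), the cell's Gibbs state `gibbsMeasure P β` on `GaugeField P 0 G` carries the five
sentences `mPos G 0 ρ ≤ m`, `Measurable (c_ρ)`, `MeasurePreserving c_ρ`, `c_ρ ∘ c_ρ = id`,
`IsReflectionPositiveBdd (gibbsMeasure P β) (mPos G 0 ρ) c_ρ` for W3f's positive σ-algebra `mPos` (bonds of the half-torus
`0 ≤ x_ρ < N₀∕2`) and the centre reflection `GaugeField.creflect ρ` — the DISPLAYED base package `(hm, hθm, hθ, hθθ, hRP)`
of `HistoryRPDeterministic.rpPackage_level_deterministic` at level `0`, now a theorem.  Proof: W3c's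
`rpPackage_wilson_theta (swap 0 ρ) (−e_ρ)` transported back along `toConfig` (§0, file 1's state dictionary, §1) and
restricted to `mPos` (§2); measure preservation from the exact symmetry (file 1). [folklore] -/
theorem rpPackage_gibbs_creflect (hhaar : (HaarData.haar : Measure G) = haarProbability G) (hϱ : Continuous ϱ)
    (hN : N ≠ 0) (hre : ∀ g : G, reTr g * N = ((ϱ g).trace).re) {β : ℝ} (hβ : 0 ≤ β) (ρ : Fin P.d) :
    mPos G 0 ρ ≤ (inferInstance : MeasurableSpace (GaugeField P 0 G)) ∧
      Measurable (GaugeField.creflect (P := P) (j := 0) (G := G) ρ) ∧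
      MeasurePreserving (GaugeField.creflect (P := P) (j := 0) (G := G) ρ)
        (T4GenFunBounds.gibbsMeasure (G := G) P β) (T4GenFunBounds.gibbsMeasure (G := G) P β) ∧
      ((GaugeField.creflect (P := P) (j := 0) (G := G) ρ) ∘ GaugeField.creflect ρ = id) ∧
      IsReflectionPositiveBdd (T4GenFunBounds.gibbsMeasure (G := G) P β) (mPos G 0 ρ)
        (GaugeField.creflect (P := P) (j := 0) (G := G) ρ) := by
  refine ⟨mPos_le G 0 ρ, measurable_creflect ρ, HistoryRPGibbsState.measurePreserving_creflect hβ ρ,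
    creflect_comp_self ρ, ?_⟩
  have hβ' : 0 ≤ β / N := div_nonneg hβ (Nat.cast_nonneg N)
  obtain ⟨hm', hΘm, -, -, hRP'⟩ := HistoryRPBase.rpPackage_wilson_theta (d := P.d) (L := P.sitesPerDir 0) ϱ
    (even_sitesPerDir P 0) hϱ hβ' (Equiv.swap 0 ρ) (Pi.single ρ (-1) : Fin P.d → ZMod (P.sitesPerDir 0))
  have hT := isReflectionPositiveBdd_transfer hm' measurable_toConfig (ofConfig_toConfig (P := P) (j := 0) (G := G))
    (toConfig_ofConfig (P := P) (j := 0) (G := G))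
    (HistoryRPGibbsState.map_toConfig_gibbsMeasure (P := P) ϱ hhaar hN hre hβ) hΘm (fun U => toConfig_creflect_theta ρ U)
    hRP'
  exact isReflectionPositiveBdd_anti (mPos_le_comap ρ) hT

/-- **THE `SU(N)` CASE, NO HYPOTHESIS ON THE GROUP LEFT** (f1's `UnitaryModel` instances: `HaarData` = normalised Haar by
`rfl`, `reTr = Re tr ∕ N` by `reTr_mul_card_SU`, the fundamental representation continuous): for `β ≥ 0` and every axis
`ρ`, the five sentences for the Gibbs state of `SU(N)` lattice gauge theory on Bałaban's `T^{(0)}`. [folklore] -/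
theorem rpPackage_gibbs_creflect_SU {n : ℕ} [NeZero n] (P : Params) {β : ℝ} (hβ : 0 ≤ β) (ρ : Fin P.d) :
    mPos (Matrix.specialUnitaryGroup (Fin n) ℂ) 0 ρ ≤
        (inferInstance : MeasurableSpace (GaugeField P 0 (Matrix.specialUnitaryGroup (Fin n) ℂ))) ∧
      Measurable (GaugeField.creflect (P := P) (j := 0) (G := Matrix.specialUnitaryGroup (Fin n) ℂ) ρ) ∧
      MeasurePreserving (GaugeField.creflect (P := P) (j := 0) (G := Matrix.specialUnitaryGroup (Fin n) ℂ) ρ)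
        (T4GenFunBounds.gibbsMeasure (G := Matrix.specialUnitaryGroup (Fin n) ℂ) P β)
        (T4GenFunBounds.gibbsMeasure (G := Matrix.specialUnitaryGroup (Fin n) ℂ) P β) ∧
      ((GaugeField.creflect (P := P) (j := 0) (G := Matrix.specialUnitaryGroup (Fin n) ℂ) ρ) ∘
          GaugeField.creflect ρ = id) ∧
      IsReflectionPositiveBdd (T4GenFunBounds.gibbsMeasure (G := Matrix.specialUnitaryGroup (Fin n) ℂ) P β)
        (mPos (Matrix.specialUnitaryGroup (Fin n) ℂ) 0 ρ)
        (GaugeField.creflect (P := P) (j := 0) (G := Matrix.specialUnitaryGroup (Fin n) ℂ) ρ) :=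
  rpPackage_gibbs_creflect (Literature.MathematicalPhysics.QuantumLattice.fundamentalRep (Fin n)) rfl
    (Literature.MathematicalPhysics.QuantumLattice.continuous_fundamentalRep (Fin n)) (NeZero.ne n) reTr_mul_card_SU hβ ρ

end Package

/-! ## §4 Sanity: the package feeds one δ-averaging level of W3d BY NAME -/

section Sanity

open ProbabilityTheory

variable {P : Params} {G : Type*} [GaugeGroup G] [MeasurableSpace G] [RegularGaugeGroup G] [HaarData G]
  [TopologicalSpace G] [IsTopologicalGroup G] [CompactSpace G] [BorelSpace G]
  {N : ℕ} (ϱ : G →* Matrix (Fin N) (Fin N) ℂ)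

/-- LEVEL 0 → LEVEL 1, type-check only: the package of §3 supplies the five base binders of
`HistoryRPDeterministic.rpPackage_level_deterministic`; its remaining inputs — a block-average MAP `f` that is
`mPos`-measurable (W3f's (L2)) and a crossing-average map `g` intertwining the reflections (W3f's (R)) — stay displayed
here as hypotheses (they are W3f's file 2). [folklore] -/
example (hhaar : (HaarData.haar : Measure G) = haarProbability G) (hϱ : Continuous ϱ) (hN : N ≠ 0)
    (hre : ∀ g : G, reTr g * N = ((ϱ g).trace).re) {β : ℝ} (hβ : 0 ≤ β) (ρ : Fin P.d)
    {Y Z : Type*} [mY : MeasurableSpace Y] [MeasurableSpace Z] {f : GaugeField P 0 G → Y} (hf : Measurable f)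
    (hfP : Measurable[mPos G 0 ρ] f) {g : GaugeField P 0 G × (Y × Y) → Z} (hg : Measurable g) {τ : Z → Z}
    (hτ : Measurable τ) (hττ : τ ∘ τ = id)
    (hsemi : ∀ p : GaugeField P 0 G × (Y × Y), g (p.1.creflect ρ, p.2.swap) = τ (g p)) :
    IsReflectionPositiveBdd
      (((T4GenFunBounds.gibbsMeasure (G := G) P β) ⊗ₘ
          ((Kernel.deterministic f hf) ×ₖ (Kernel.deterministic f hf).comap (GaugeField.creflect ρ)
            (measurable_creflect ρ))) ⊗ₘ Kernel.deterministic g hg)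
      ((((mPos G 0 ρ).prod mY).comap (fun p : GaugeField P 0 G × (Y × Y) => (p.1, p.2.1))).comap
        (Prod.fst : (GaugeField P 0 G × (Y × Y)) × Z → GaugeField P 0 G × (Y × Y)))
      (fun q : (GaugeField P 0 G × (Y × Y)) × Z => ((q.1.1.creflect ρ, q.1.2.swap), τ q.2)) := by
  haveI := T4GenFunBounds.isProbabilityMeasure_gibbsMeasure (G := G) P hβ
  obtain ⟨h1, h2, h3, h4, h5⟩ := rpPackage_gibbs_creflect (P := P) ϱ hhaar hϱ hN hre hβ ρ
  exact (HistoryRPDeterministic.rpPackage_level_deterministic h1 h2 h3 h4 h5 hf hfP hg hτ hττ hsemi).2.2.2.2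

end Sanity

end

end Summit.QuantumFields.BalabanUV.T4Continuum.HistoryRPGibbs
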